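import Summits.QuantumFields.YangMills.Theses.FradkinShenkerFlow
import Literature.Probability.Moments.EfronSteinProofs

/-!
# Stub `stub_productVariance_le` (N4) of the line `rg-variance-cascade` (crux `SusceptibilityToPoincare`)

Route `FradkinShenkerFlow` of `YangMills`, crux item `stmt-QuantumFields-9441`
(`Summit.QuantumFields.YangMills.Theses.FradkinShenkerFlow.SusceptibilityToPoincare`), necessity
package "UP ⇒ TerminalPoincare" of the line `rg-variance-cascade`, rider N4: **the Efron–Stein
inequality with coordinate-free approximants** (Steele's form of the inequality, up to the
constant).  On a finite product `Π i, Ω i` of probability spaces with law `π = ⨂ᵢ μᵢ`, for a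
bounded measurable `g` and ANY bounded measurable `cᵢ` that does not depend on coordinate `i`
(`cᵢ (update x i y) = cᵢ x`),

  `∫ (g − ∫ g dπ)² dπ ≤ 2 Σᵢ ∫ (g − cᵢ)² dπ`.

It is an unconditional theorem of abstract probability (heterogeneous coordinate spaces, any
finite index type); the lead applies it fibrewise to the product of the laws of the block noises.

## Proof

* The left-hand side is `Var_π g` (`ProbabilityTheory.variance_eq_integral`; `g` is bounded, so
  square-integrable, `MemLp.of_bound`), and the tree's **Efron–Stein inequality**
  (`Literature.Probability.Moments.EfronSteinInequality_holds`, independent-copy form) gives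
  `Var_π g ≤ ½ Σᵢ ∫ ∫ (g x − g (update x i y))² dμᵢ(y) dπ(x)`.
* For each `i` the resampling term is at most `4 ∫ (g − cᵢ)² dπ`
  (`ProductVariance.resample_sq_le`): by Fubini
  (`Literature.Probability.Moments.EfronStein.integral_sq_sub_eq`) it is the integral of
  `(g X − g Xⁱ)²` over the doubled product space `(Π i, Ω i × Ω i, ⨂ᵢ (μᵢ ⊗ μᵢ))` carrying two
  independent copies `X = ((ω j).1)ⱼ`, `X' = ((ω j).2)ⱼ` and `Xⁱ = update X i (X' i)`; pointwise
  `(g X − g Xⁱ)² ≤ 2 (g X − cᵢ X)² + 2 (g Xⁱ − cᵢ Xⁱ)²` because `cᵢ Xⁱ = cᵢ X`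
  (`(a − b)² + (a + b − 2c)² = 2 (a − c)² + 2 (b − c)²`); and both `X` and `Xⁱ` have law `π`
  (`Literature.Probability.Moments.EfronStein.measurePreserving_read`), so each of the two terms
  integrates to `2 ∫ (g − cᵢ)² dπ`.
* Summing over `i`: `½ Σᵢ 4 ∫ (g − cᵢ)² dπ = 2 Σᵢ ∫ (g − cᵢ)² dπ`.
-/

noncomputable section

open MeasureTheory ProbabilityTheory
open Literature.MathematicalPhysics.QuantumFieldTheory

namespace Summit.QuantumFields.YangMills.Theorems.SusceptibilityToPoincare.RgVarianceCascade

/-! ### Abstract probability: the resampling term against a coordinate-free approximant -/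

namespace ProductVariance

open Literature.Probability.Moments

variable {ι : Type*} [Fintype ι] [DecidableEq ι] {Ω : ι → Type*} [∀ i, MeasurableSpace (Ω i)]

/-- `(a − b)² ≤ 2 (a − c)² + 2 (b − c)²`: the difference of the two sides is `(a + b − 2c)²`.
[folklore] -/
theorem sq_sub_le_two_mul_add (a b c : ℝ) :
    (a - b) ^ 2 ≤ 2 * (a - c) ^ 2 + 2 * (b - c) ^ 2 := by
  nlinarith [sq_nonneg (a + b - 2 * c)]

/-- A measurable real function bounded in absolute value is square-integrable for a finite
measure. [folklore] -/
theorem memLp_two_of_abs_le {α : Type*} [MeasurableSpace α] {ν : Measure α} [IsFiniteMeasure ν]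
    {f : α → ℝ} (hf : Measurable f) {M : ℝ} (hM : ∀ x, |f x| ≤ M) : MemLp f 2 ν :=
  MemLp.of_bound hf.aestronglyMeasurable M
    (ae_of_all _ fun x => by simpa only [Real.norm_eq_abs] using hM x)

/-- **The resampling term against a coordinate-free approximant.** On the product probability
space `(Π i, Ω i, π = ⨂ᵢ μᵢ)`, for bounded measurable `g` and `c` with `c (update x i y) = c x`
for all `x`, `y`:  `∫ ∫ (g x − g (update x i y))² dμᵢ(y) dπ(x) ≤ 4 ∫ (g − c)² dπ`.
Proof on the doubled space `⨂ᵢ (μᵢ ⊗ μᵢ)`: the iterated integral is `E (g X − g Xⁱ)²` with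
`Xⁱ = update X i (X' i)` (`EfronStein.integral_sq_sub_eq`), pointwise
`(g X − g Xⁱ)² ≤ 2 (g X − c X)² + 2 (g Xⁱ − c Xⁱ)²` as `c Xⁱ = c X`, and `X`, `Xⁱ` both have
law `π` (`EfronStein.measurePreserving_read`). [folklore] -/
theorem resample_sq_le (μ : ∀ i, Measure (Ω i)) [∀ i, IsProbabilityMeasure (μ i)]
    {g : (∀ i, Ω i) → ℝ} (hgm : Measurable g) {M : ℝ} (hgM : ∀ x, |g x| ≤ M)
    {c : (∀ i, Ω i) → ℝ} (hcm : Measurable c) {N : ℝ} (hcN : ∀ x, |c x| ≤ N) (i : ι)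
    (hc : ∀ x y, c (Function.update x i y) = c x) :
    ∫ x, (∫ y, (g x - g (Function.update x i y)) ^ 2 ∂μ i) ∂Measure.pi μ ≤
      4 * ∫ x, (g x - c x) ^ 2 ∂Measure.pi μ := by
  -- the bookkeeping maps of the doubled space `Π i, (Ω i × Ω i)`: read the first copy with the
  -- coordinates in `S` taken from the second copy (`rd S`) / swap the two copies on `S` (`fl S`)
  obtain ⟨rd, hrd⟩ : ∃ rd : Finset ι → (∀ i, Ω i × Ω i) → ∀ i, Ω i,
      ∀ S ω j, rd S ω j = if j ∈ S then (ω j).2 else (ω j).1 := ⟨_, fun _ _ _ => rfl⟩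
  obtain ⟨fl, hfl⟩ : ∃ fl : Finset ι → (∀ i, Ω i × Ω i) → ∀ i, Ω i × Ω i,
      ∀ S ω j, fl S ω j = if j ∈ S then (ω j).swap else ω j := ⟨_, fun _ _ _ => rfl⟩
  have hg : MemLp g 2 (Measure.pi μ) := memLp_two_of_abs_le hgm hgM
  have hc2 : MemLp c 2 (Measure.pi μ) := memLp_two_of_abs_le hcm hcN
  -- Fubini: the iterated integral is the doubled-space expectation of `(g X − g Xⁱ)²`
  rw [← EfronStein.integral_sq_sub_eq μ hrd hfl hgm hg i]
  -- both readings `X = rd ∅ ω` and `Xⁱ = rd {i} ω` have law `π`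
  have hφ : AEStronglyMeasurable (fun x => (g x - c x) ^ 2) (Measure.pi μ) :=
    ((hgm.sub hcm).pow_const 2).aestronglyMeasurable
  have hI : ∀ S, ∫ ω, (g (rd S ω) - c (rd S ω)) ^ 2 ∂Measure.pi (fun i => (μ i).prod (μ i)) =
      ∫ x, (g x - c x) ^ 2 ∂Measure.pi μ := fun S =>
    EfronStein.integral_comp_eq (EfronStein.measurePreserving_read μ hrd hfl S) hφ
  have hInt : ∀ S, Integrable (fun ω => (g (rd S ω) - c (rd S ω)) ^ 2)
      (Measure.pi fun i => (μ i).prod (μ i)) := fun S =>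
    ((EfronStein.memLp_read μ hrd hfl hg S).sub (EfronStein.memLp_read μ hrd hfl hc2 S)).integrable_sq
  -- the approximant does not see the resampled coordinate
  have hci : ∀ ω, c (rd {i} ω) = c (rd ∅ ω) := fun ω => by
    rw [EfronStein.read_singleton hrd i ω, EfronStein.read_empty hrd ω, hc]
  have hpt : ∀ ω, (g (rd ∅ ω) - g (rd {i} ω)) ^ 2 ≤
      2 * (g (rd ∅ ω) - c (rd ∅ ω)) ^ 2 + 2 * (g (rd {i} ω) - c (rd {i} ω)) ^ 2 := fun ω => by
    rw [hci ω]
    exact sq_sub_le_two_mul_add _ _ _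
  calc ∫ ω, (g (rd ∅ ω) - g (rd {i} ω)) ^ 2 ∂Measure.pi (fun i => (μ i).prod (μ i))
      ≤ ∫ ω, (2 * (g (rd ∅ ω) - c (rd ∅ ω)) ^ 2 + 2 * (g (rd {i} ω) - c (rd {i} ω)) ^ 2)
          ∂Measure.pi (fun i => (μ i).prod (μ i)) :=
        integral_mono_of_nonneg (ae_of_all _ fun ω => sq_nonneg _)
          (((hInt ∅).const_mul 2).add ((hInt {i}).const_mul 2)) (ae_of_all _ hpt)
    _ = 4 * ∫ x, (g x - c x) ^ 2 ∂Measure.pi μ := by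
        rw [integral_add ((hInt ∅).const_mul 2) ((hInt {i}).const_mul 2), integral_const_mul,
          integral_const_mul, hI ∅, hI {i}]
        ring

end ProductVariance

/-! ### The registered stub -/

/-- `stub_productVariance_le` — **N4, Efron–Stein with coordinate-free approximants.** For EVERY
finite index type `ι`, measurable spaces `Ω i` with probability measures `μ i`, every bounded
measurable `g : (Π i, Ω i) → ℝ` and every family of bounded measurable `c i` with
`c i (update x i y) = c i x` (the `i`-th approximant does not depend on coordinate `i`):
`∫ (g − ∫ g d⨂μ)² d⨂μ ≤ 2 Σᵢ ∫ (g − c i)² d⨂μ`.  The left-hand side is the variance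
(`ProbabilityTheory.variance_eq_integral`), bounded by the tree's Efron–Stein inequality
(`Literature.Probability.Moments.EfronSteinInequality_holds`), whose `i`-th resampling term is at
most `4 ∫ (g − c i)²` (`ProductVariance.resample_sq_le`); `½ · 4 = 2`. [folklore] -/
theorem stub_productVariance_le :
    ∀ (ι : Type) [Fintype ι] [DecidableEq ι] (Ω : ι → Type) [∀ i, MeasurableSpace (Ω i)]
      (μ : (i : ι) → Measure (Ω i)) [∀ i, IsProbabilityMeasure (μ i)]
      (g : ((i : ι) → Ω i) → ℝ), Measurable g → (∃ M : ℝ, ∀ x, |g x| ≤ M) →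
      ∀ (c : ι → ((i : ι) → Ω i) → ℝ), (∀ i, Measurable (c i)) → (∀ i, ∃ M : ℝ, ∀ x, |c i x| ≤ M) →
      (∀ i x y, c i (Function.update x i y) = c i x) →
      ∫ x, (g x - ∫ x', g x' ∂Measure.pi μ) ^ 2 ∂Measure.pi μ ≤
        2 * ∑ i, ∫ x, (g x - c i x) ^ 2 ∂Measure.pi μ := by
  intro ι _ _ Ω _ μ _ g hgm hgb c hcm hcb hc
  obtain ⟨M, hM⟩ := hgb
  rw [← ProbabilityTheory.variance_eq_integral hgm.aemeasurable]
  refine (Literature.Probability.Moments.EfronSteinInequality_holds ι Ω μ g hgm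
    (ProductVariance.memLp_two_of_abs_le hgm hM)).trans ?_
  rw [Finset.mul_sum, Finset.mul_sum]
  refine Finset.sum_le_sum fun i _ => ?_
  obtain ⟨N, hN⟩ := hcb i
  have h := ProductVariance.resample_sq_le μ hgm hM (hcm i) hN i (hc i)
  linarith

end Summit.QuantumFields.YangMills.Theorems.SusceptibilityToPoincare.RgVarianceCascade

end
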